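import Literature.AlgebraicGeometry.Morphisms.SectionsRankOfFibreVanishing
import Literature.AlgebraicGeometry.Modules.PushforwardUnitHasRankOfFinrank
import Literature.AlgebraicGeometry.Modules.PushforwardBaseChangeRestrictBase
import Literature.AlgebraicGeometry.Modules.DetClassOfIso
import Literature.AlgebraicGeometry.Morphisms.ProperPushforwardCoh
import Mathlib.RingTheory.IsTensorProduct
import HarnessLib

/-!
# `p_* G` is finite locally free of rank `h⁰` when `H¹` of the fibres vanishes — general locally noetherian base

[cite: MumfordAV1970, §5, Corollary 2 (p. 50) and Corollary 3 (p. 53)]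
[cite: Hartshorne1977, III Theorem 12.11 (p. 290) and Corollary 12.9 (p. 288)]
[cite: MumfordFogartyKirwan1994, Ch. 6 §2 Proposition 6.13 (p. 123)]

The SHEAF form of ★ `Morphisms/SectionsProjectiveOfFibreVanishing` (FILE A: `Γ(X, G)` finite projective) and ★
`Morphisms/SectionsRankOfFibreVanishing` (FILE A2: of stalk rank `h⁰`), over a general locally noetherian base: `S` locally
noetherian, `p : X → S` proper and flat, `G` finite locally free on `X` with `p_* G` affine-localizing, and on EVERY fibre square
`X₀ = X ×_S Spec K` over a field point `Spec K → S`

* `hvan`: `Ext¹(𝒪_{X₀}, G|_{X₀}) = 0` (verbatim the binder of ★ G10 `Modules.isIso_pushforwardBaseChangeHom_of_forall_fieldPoint`),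
* `hrank`: `dim_{Γ(Spec K, 𝒪)} Γ(X₀, G|_{X₀}) = r` (the `SecMod` currency of ★ `Modules.finrank_secMod_top_eq_of_isPullback_specMap`);

then **`HasRank (p_* G) r`** (`hasRank_pushforward_of_forall_fieldPoint`; `…_of_compactSpace` drops the affine-localizing
hypothesis over a quasi-compact base, ★ `isAffineLocalizing_pushforward`), in particular `p_* G` is finite locally free
(`isFiniteLocallyFree_pushforward_of_forall_fieldPoint`).  MFK Prop. 6.13: «`π_* L` is locally free of rank `r`».

Proof.  §1: the chart `p_V : p⁻¹V → V ≅ Spec Γ(S, V)` over an affine open `V` is proper flat and its canonical fibres are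
fibre squares of `p` over field points (`isPullback_fiberι_comp_ι`, Mathlib `isPullback_morphismRestrict` pasted to the fibre).
§2 (`finite_projective_rankAtStalk_app_pushforward`): FILE A/A2 make `Γ(p⁻¹V, G|)` finite projective of stalk rank `r` over
`Γ(Spec Γ(S, V), 𝒪)`; this is moved to the sections `Γ(p_* G, V) = Γ(G, p⁻¹V)` over `Γ(S, V)` along the ring isomorphism
`ΓSpecIso` and the additive bijection of ★ (S3) `exists_sections_pullback_ι_transport` — a semilinear isomorphism, under which
finiteness (`Module.Finite.of_addEquiv_semilinear`), projectivity (Mathlib `Module.Projective.of_equiv`, semilinear) and the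
stalk rank (Mathlib `Module.rankAtStalk_isBaseChange`, the target being a base change along the isomorphism —
`IsBaseChange.of_lift_unique`) travel.  §3: the frame-system road of ★ `hasRank_pushforward_unit_of_finrank_eq` — a basis of a
localisation `Γ(p_* G, V)_g`, `g ∉ 𝔭_y` (★ `exists_basis_localizedModule_away`), frames `p_* G` on `D(g)` (★
`nonempty_basis_sections_basicOpen`, ★ `nonempty_free_iso_over_of_basis`) with `r` elements (★
`natCard_eq_rankAtStalk_of_basis_localizedModule_away`); ★ `FrameSystem.hasRank`.

Theorems only (one `private` transport of `Ext¹`-vanishing along `pullbackComp`); no instance, notation, named fact.  Universe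
`Scheme.{0}`.  Cell `hodgecm-mathlib`, F-DAG F-6 (VI) assembler FILE B (B-p04 (g20), B-plan1 (g16) 07:42:19Z); consumer: the
hypothesis `hR : HasRank ((pushforward p).obj G) r` of ★ `Modules/CompleteLinearSystemLocus` (B-p06 (g12), p766190) — MFK Prop. 7.3
step (VI) «the embedding is the complete linear system».  HC_CM is proved only modulo the 7 printed citations until rung 0 closes —
nothing here bears on a summit statement.

## References

* D. Mumford, *Abelian Varieties*, TIFR Studies in Mathematics 5 (1970), §5, Cor. 2 (p. 50), Cor. 3 (p. 53). [MumfordAV1970]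
* R. Hartshorne, *Algebraic Geometry*, GTM 52 (1977), III Thm. 12.11 (p. 290), Cor. 12.9 (p. 288); III Prop. 9.3; II Prop. 5.8.
  [Hartshorne1977]
* D. Mumford, J. Fogarty, F. Kirwan, *Geometric Invariant Theory*, 3rd ed. (1994), Ch. 6 §2 Prop. 6.13 (p. 123). [MumfordFogartyKirwan1994]
-/

noncomputable section

set_option backward.isDefEq.respectTransparency false

open CategoryTheory CategoryTheory.Limits CategoryTheory.Abelian Opposite TopologicalSpace AlgebraicGeometry TensorProduct

namespace Literature.AlgebraicGeometry.Modules

open Literature.AlgebraicGeometry.Morphisms Literature.AlgebraicGeometry.HodgeTheory Literature.AlgebraicGeometry.Motives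

/-! ## §1 The affine chart `p_V : p⁻¹V → V ≅ Spec Γ(S, V)` and its fibres -/

section Chart

variable {S X : Scheme.{0}} (p : X ⟶ S) (V : S.Opens) (hV : IsAffineOpen V)

/-- The square `p⁻¹V ↪ X`, `p_V ≫ (V ≅ Spec Γ(S, V))`, `p`, `Spec Γ(S, V) ≅ V ↪ S` is cartesian (Mathlib `isPullback_morphismRestrict`
moved along `IsAffineOpen.isoSpec`). [cite: Hartshorne1977, III Prop. 9.3 (proof)] -/
theorem isPullback_ι_resLE_comp_isoSpec :
    IsPullback (p ⁻¹ᵁ V).ι (p.resLE V (p ⁻¹ᵁ V) le_rfl ≫ hV.isoSpec.hom) p (hV.isoSpec.inv ≫ V.ι) := by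
  have h := (isPullback_morphismRestrict p V).flip
  rw [← Scheme.Hom.resLE_eq_morphismRestrict] at h
  exact h.of_iso (Iso.refl _) (Iso.refl _) hV.isoSpec (Iso.refl _) (by simp) (by simp) (by simp) (by simp)

/-- **The canonical fibre of the chart `p⁻¹V → Spec Γ(S, V)` at `y`, followed by `p⁻¹V ↪ X`, is a fibre square of `p` over the
field point `Spec κ(y) → S`.** [cite: Hartshorne1977, III Prop. 9.3 (proof)] -/
theorem isPullback_fiberι_comp_ι (y : Spec Γ(S, V)) :
    IsPullback ((p.resLE V (p ⁻¹ᵁ V) le_rfl ≫ hV.isoSpec.hom).fiberι y ≫ (p ⁻¹ᵁ V).ι)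
      ((p.resLE V (p ⁻¹ᵁ V) le_rfl ≫ hV.isoSpec.hom).fiberToSpecResidueField y) p
      ((Spec Γ(S, V)).fromSpecResidueField y ≫ hV.isoSpec.inv ≫ V.ι) :=
  (IsPullback.of_hasPullback _ _).paste_horiz (isPullback_ι_resLE_comp_isoSpec p V hV)

/-- The same fibre square with base point written `Spec (algebraMap Γ(S, V) κ(y))` (the shape of ★
`isPullback_fiberι_SpecMap_algebraMap`). [cite: Hartshorne1977, III Prop. 9.3 (proof)] -/
theorem isPullback_fiberι_comp_ι_SpecMap (y : Spec Γ(S, V)) :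
    IsPullback ((p.resLE V (p ⁻¹ᵁ V) le_rfl ≫ hV.isoSpec.hom).fiberι y ≫ (p ⁻¹ᵁ V).ι)
      ((p.resLE V (p ⁻¹ᵁ V) le_rfl ≫ hV.isoSpec.hom).fiberToSpecResidueField y ≫
        Spec.map (Scheme.Spec.residueFieldIso Γ(S, V) y).inv) p
      (Spec.map (CommRingCat.ofHom (algebraMap Γ(S, V) y.asIdeal.ResidueField)) ≫ hV.isoSpec.inv ≫ V.ι) :=
  (isPullback_fiberι_SpecMap_algebraMap (A := Γ(S, V)) (p.resLE V (p ⁻¹ᵁ V) le_rfl ≫ hV.isoSpec.hom) y).paste_horiz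
    (isPullback_ι_resLE_comp_isoSpec p V hV)

/-- `Ext¹(𝒪, ·) = 0` passes from `(n ≫ m)^* G` to `n^* m^* G` (Mathlib `Scheme.Modules.pullbackComp`). [folklore] -/
private theorem subsingleton_ext_pullback_pullback {Y Z X : Scheme.{0}} (n : Y ⟶ Z) (m : Z ⟶ X) (G : X.Modules)
    (h : Subsingleton (Ext.{1} (unitModule Y) ((Scheme.Modules.pullback (n ≫ m)).obj G) 1)) :
    Subsingleton (Ext.{1} (unitModule Y) ((Scheme.Modules.pullback n).obj ((Scheme.Modules.pullback m).obj G)) 1) := by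
  let Φ : (Scheme.Modules.pullback n).obj ((Scheme.Modules.pullback m).obj G) ≅ (Scheme.Modules.pullback (n ≫ m)).obj G :=
    (Scheme.Modules.pullbackComp n m).app G
  refine ⟨fun x y => ?_⟩
  have key : ∀ z : Ext.{1} (unitModule Y) ((Scheme.Modules.pullback n).obj ((Scheme.Modules.pullback m).obj G)) 1,
      z = (z.comp (Ext.mk₀ Φ.hom) (add_zero 1)).comp (Ext.mk₀ Φ.inv) (add_zero 1) := fun z => by
    rw [Ext.comp_assoc_of_second_deg_zero, Ext.mk₀_comp_mk₀, Iso.hom_inv_id, Ext.comp_mk₀_id]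
  rw [key x, key y, Subsingleton.elim (x.comp _ _) (y.comp (Ext.mk₀ Φ.hom) (add_zero 1))]

end Chart

/-! ## §2 Over an affine chart: `Γ(p_* G, V)` is finite projective of rank `r` over `Γ(S, V)` -/

section AffineChart

variable {S X : Scheme.{0}} [IsLocallyNoetherian S] {p : X ⟶ S} [IsProper p] [Flat p] (G : X.Modules)
  (hL : IsFiniteLocallyFree G) (r : ℕ)
  (hvan : ∀ ⦃K : Type⦄ [Field K] ⦃X₀ : Scheme.{0}⦄ (i : X₀ ⟶ X) (f₀ : X₀ ⟶ Spec (CommRingCat.of K))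
    (x : Spec (CommRingCat.of K) ⟶ S), IsPullback i f₀ p x →
      Subsingleton (Ext.{1} (unitModule X₀) ((Scheme.Modules.pullback i).obj G) 1))
  (hrank : ∀ ⦃K : Type⦄ [Field K] ⦃X₀ : Scheme.{0}⦄ (i : X₀ ⟶ X) (f₀ : X₀ ⟶ Spec (CommRingCat.of K))
    (x : Spec (CommRingCat.of K) ⟶ S), IsPullback i f₀ p x →
      Module.finrank Γ(Spec (CommRingCat.of K), ⊤) (SecMod ((Scheme.Modules.pullback i).obj G) f₀.appTop.hom ⊤) = r)
  {V : S.Opens} (hV : IsAffineOpen V)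

include hL hvan hrank hV in
/-- **Over an affine open `V ⊆ S`: `Γ(p_* G, V) = Γ(p⁻¹V, G)` is a finitely generated projective `Γ(S, V)`-module of rank `r`
at every prime** — FILE A/A2 (★ `finite_and_projective_secMod_top_of_forall_fiber`, ★ `rankAtStalk_secMod_top_eq_of_forall_fiber`)
on the chart `p⁻¹V → Spec Γ(S, V)`, whose canonical fibres are fibre squares of `p` over field points (`isPullback_fiberι_comp_ι`),
transported to the sections `Γ(p_* G, V)` along `Γ(Spec Γ(S, V), 𝒪) ≅ Γ(S, V)` and `Γ(p⁻¹V, G|) ≅ Γ(G, p⁻¹V)` (★ (S3)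
`exists_sections_pullback_ι_transport`); the rank moves by Mathlib `Module.rankAtStalk_isBaseChange`.
[cite: MumfordAV1970, §5 Cor. 2 (p. 50)] [cite: Hartshorne1977, III Thm. 12.11 (p. 290), Cor. 12.9] -/
theorem finite_projective_rankAtStalk_app_pushforward :
    Module.Finite Γ(S, V) Γ((Scheme.Modules.pushforward p).obj G, V) ∧
      Module.Projective Γ(S, V) Γ((Scheme.Modules.pushforward p).obj G, V) ∧
        ∀ 𝔭 : PrimeSpectrum Γ(S, V), Module.rankAtStalk (R := Γ(S, V)) Γ((Scheme.Modules.pushforward p).obj G, V) 𝔭 = r := by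
  haveI : IsAffine (V : Scheme.{0}) := hV
  haveI : IsNoetherianRing Γ(S, V) := IsLocallyNoetherian.component_noetherian ⟨V, hV⟩
  -- the chart `fV : p⁻¹V → Spec Γ(S, V)`, proper and flat, and the bundle `GV = G|_{p⁻¹V}`
  haveI : IsProper (p.resLE V (p ⁻¹ᵁ V) le_rfl ≫ hV.isoSpec.hom) := by
    rw [Scheme.Hom.resLE_eq_morphismRestrict]; infer_instance
  haveI : Flat (p.resLE V (p ⁻¹ᵁ V) le_rfl ≫ hV.isoSpec.hom) := by
    rw [Scheme.Hom.resLE_eq_morphismRestrict]; infer_instance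
  have exf : ∃ fV : (p ⁻¹ᵁ V).toScheme ⟶ Spec (CommRingCat.of Γ(S, V)), fV = p.resLE V (p ⁻¹ᵁ V) le_rfl ≫ hV.isoSpec.hom :=
    ⟨_, rfl⟩
  obtain ⟨fV, hfV⟩ := exf
  haveI : IsProper fV := by rw [hfV]; infer_instance
  haveI : Flat fV := by rw [hfV]; infer_instance
  let GV : (p ⁻¹ᵁ V).toScheme.Modules := (Scheme.Modules.pullback (p ⁻¹ᵁ V).ι).obj G
  have hLV : IsFiniteLocallyFree GV := hL.pullback _
  -- its canonical fibres are fibre squares of `p` over field points: `hvan`, `hrank` apply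
  have hvan1 : ∀ y : Spec (CommRingCat.of Γ(S, V)),
      Subsingleton (Ext.{1} (unitModule (fV.fiber y)) ((Scheme.Modules.pullback (fV.fiberι y)).obj GV) 1) := by
    intro y
    subst hfV
    exact subsingleton_ext_pullback_pullback _ _ G (hvan _ _ _ (isPullback_fiberι_comp_ι p V hV y))
  have hrank1 : ∀ y : Spec (CommRingCat.of Γ(S, V)),
      Module.finrank Γ(Spec (CommRingCat.of y.asIdeal.ResidueField), ⊤)
        (SecMod ((Scheme.Modules.pullback (fV.fiberι y)).obj GV)
          (fV.fiberToSpecResidueField y ≫ Spec.map (Scheme.Spec.residueFieldIso (CommRingCat.of Γ(S, V)) y).inv).appTop.hom ⊤)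
        = r := by
    intro y
    subst hfV
    obtain ⟨L, -⟩ := exists_secMod_linearEquiv_of_iso
      (M := (Scheme.Modules.pullback ((p.resLE V (p ⁻¹ᵁ V) le_rfl ≫ hV.isoSpec.hom).fiberι y ≫ (p ⁻¹ᵁ V).ι)).obj G)
      (N := (Scheme.Modules.pullback ((p.resLE V (p ⁻¹ᵁ V) le_rfl ≫ hV.isoSpec.hom).fiberι y)).obj GV)
      (((p.resLE V (p ⁻¹ᵁ V) le_rfl ≫ hV.isoSpec.hom).fiberToSpecResidueField y ≫
        Spec.map (Scheme.Spec.residueFieldIso (CommRingCat.of Γ(S, V)) y).inv).appTop.hom)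
      ((Scheme.Modules.pullbackComp ((p.resLE V (p ⁻¹ᵁ V) le_rfl ≫ hV.isoSpec.hom).fiberι y) (p ⁻¹ᵁ V).ι).app G).symm
    rw [← L.finrank_eq]
    exact hrank _ _ _ (isPullback_fiberι_comp_ι_SpecMap p V hV y)
  -- FILE A / A2 on the chart: `M₁ = Γ(p⁻¹V, G|)` is finite projective of rank `r` over `R = Γ(Spec Γ(S, V), 𝒪)`
  obtain ⟨hfin₁, hproj₁⟩ := finite_and_projective_secMod_top_of_forall_fiber fV GV hLV hvan1
  have hrk₁ := rankAtStalk_secMod_top_eq_of_forall_fiber fV GV hLV hvan1 r hrank1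
  haveI := hfin₁
  haveI := hproj₁
  -- the transport `(σ, μ)`: `σ : Γ(Spec Γ(S, V), 𝒪) ≅ Γ(S, V)`, `μ : Γ(p⁻¹V, G|) ≅ Γ(G, p⁻¹V) = Γ(p_* G, V)` (★ (S3))
  let R : Type := Γ(Spec (CommRingCat.of Γ(S, V)), ⊤)
  let M₁ : Type := SecMod GV fV.appTop.hom ⊤
  let M₂ : Type := Γ((Scheme.Modules.pushforward p).obj G, V)
  let σ : R ≃+* Γ(S, V) := (Scheme.ΓSpecIso Γ(S, V)).commRingCatIsoToRingEquiv
  have i₀ : (⊤ : (p ⁻¹ᵁ V).toScheme.Opens) ≤ (p ⁻¹ᵁ V).ι ⁻¹ᵁ (p ⁻¹ᵁ V) := (Scheme.Opens.ι_preimage_self _).ge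
  have hc : p ⁻¹ᵁ V = (p ⁻¹ᵁ V).ι ''ᵁ ⊤ := (Scheme.Opens.ι_image_top _).symm
  obtain ⟨μ, hμη, hημ, hμc⟩ := exists_sections_pullback_ι_transport G (p ⁻¹ᵁ V) ⊤ rfl i₀ hc
  let μe : M₁ ≃+ M₂ :=
    { toFun := fun t => show M₂ from μ (SecMod.val (L := GV) (ρ := fV.appTop.hom) t)
      invFun := fun m => SecMod.mk (ρ := fV.appTop.hom) (unitSectionLE (p ⁻¹ᵁ V).ι G i₀ (show Γ(G, p ⁻¹ᵁ V) from m))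
      left_inv := fun t => SecMod.val_injective (L := GV) (ρ := fV.appTop.hom) (hημ _)
      right_inv := fun m => hμη _
      map_add' := fun t t' => μ.map_add _ _ }
  -- the ring map of the chart on global sections is `p♯` read through `σ`
  have happ : ∀ a : R, X.presheaf.map (eqToHom hc).op (fV.appTop a) = p.app V (σ a) := by
    intro a
    rw [hfV, Scheme.Hom.comp_appTop, CategoryTheory.comp_apply, IsAffineOpen.isoSpec_hom_appTop,
      CategoryTheory.comp_apply]
    change X.presheaf.map (eqToHom hc).op
      ((p.resLE V (p ⁻¹ᵁ V) le_rfl).app ⊤ (V.topIso.inv ((Scheme.ΓSpecIso Γ(S, V)).hom a))) = _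
    rw [resLE_self_app_top_apply, Iso.inv_hom_id_apply, map_eqToHom_topIso_inv]
    rfl
  have htoS : ∀ a : R, toSections fV.appTop.hom ⊤ a = fV.appTop a := by
    intro a
    have e1 : (homOfLE (le_top : (⊤ : (p ⁻¹ᵁ V).toScheme.Opens) ≤ ⊤)) = 𝟙 ⊤ := Subsingleton.elim _ _
    change (p ⁻¹ᵁ V).toScheme.presheaf.map (homOfLE le_top).op (fV.appTop a) = _
    rw [e1, op_id, CategoryTheory.Functor.map_id]
    rfl
  have hsemi : ∀ (a : R) (t : M₁), μe (a • t) = σ a • μe t := by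
    intro a t
    change μ (toSections fV.appTop.hom ⊤ a • SecMod.val (L := GV) (ρ := fV.appTop.hom) t) =
      p.app V (σ a) • μ (SecMod.val (L := GV) (ρ := fV.appTop.hom) t)
    rw [htoS, hμc, happ]
  -- (a) finiteness and (b) projectivity move along `(σ, μ)`
  have hfin₂ : Module.Finite Γ(S, V) M₂ :=
    Module.Finite.of_addEquiv_semilinear (M := M₂) (N := M₁) σ.symm.toRingHom σ.symm.surjective μe.symm (fun c m => by
      apply μe.injective
      rw [AddEquiv.apply_symm_apply, hsemi, AddEquiv.apply_symm_apply]
      change c • m = σ (σ.symm c) • m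
      rw [RingEquiv.apply_symm_apply])
  haveI := RingHomInvPair.of_ringEquiv σ
  haveI := RingHomInvPair.of_ringEquiv_symm σ
  let e₂ : M₁ ≃ₛₗ[(σ : R →+* Γ(S, V))] M₂ := { μe with map_smul' := hsemi }
  have hproj₂ : Module.Projective Γ(S, V) M₂ := Module.Projective.of_equiv e₂
  -- (c) the rank: `M₂` is the base change of `M₁` along the isomorphism `σ`
  letI algRA : Algebra R Γ(S, V) := (σ : R →+* Γ(S, V)).toAlgebra
  letI modR : Module R M₂ := Module.compHom M₂ (σ : R →+* Γ(S, V))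
  haveI : IsScalarTower R Γ(S, V) M₂ :=
    ⟨fun a c m => by
      change (σ a * c) • m = σ a • (c • m)
      rw [mul_smul]⟩
  let μl : M₁ →ₗ[R] M₂ := { μe.toAddMonoidHom with map_smul' := fun a t => hsemi a t }
  have hbc : IsBaseChange Γ(S, V) μl := by
    refine IsBaseChange.of_lift_unique μl fun Q _ _ _ _ g => ?_
    have hsymm : ∀ (c : Γ(S, V)) (m : M₂), μe.symm (c • m) = σ.symm c • μe.symm m := fun c m => by
      apply μe.injective
      rw [AddEquiv.apply_symm_apply, hsemi, AddEquiv.apply_symm_apply, RingEquiv.apply_symm_apply]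
    let g' : M₂ →ₗ[Γ(S, V)] Q :=
      { toFun := fun m => g (μe.symm m)
        map_add' := fun m m' => by rw [map_add, map_add]
        map_smul' := fun c m => by
          rw [hsymm, map_smul, RingHom.id_apply, ← algebraMap_smul Γ(S, V) (σ.symm c)]
          change σ (σ.symm c) • g (μe.symm m) = c • g (μe.symm m)
          rw [RingEquiv.apply_symm_apply] }
    refine ⟨g', ?_, ?_⟩
    · ext t
      change g (μe.symm (μe t)) = g t
      rw [AddEquiv.symm_apply_apply]
    · intro g'' hg''
      ext m
      have h := congrArg (fun φ : M₁ →ₗ[R] Q => φ (μe.symm m)) hg''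
      simp only [LinearMap.coe_comp, LinearMap.coe_restrictScalars, Function.comp_apply] at h
      change g'' (μl (μe.symm m)) = g (μe.symm m) at h
      change g'' m = g (μe.symm m)
      rw [← h]
      change g'' m = g'' (μe (μe.symm m))
      rw [AddEquiv.apply_symm_apply]
  haveI : Module.Flat R M₁ := Module.Flat.of_projective
  have hrk₂ : ∀ 𝔭 : PrimeSpectrum Γ(S, V), Module.rankAtStalk (R := Γ(S, V)) M₂ 𝔭 = r := fun 𝔭 => by
    rw [Module.rankAtStalk_isBaseChange hbc 𝔭]
    exact hrk₁ _
  exact ⟨hfin₂, hproj₂, hrk₂⟩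

end AffineChart

/-! ## §3 The frames: `p_* G` has rank `r` -/

section HasRank

/-- **`p_* G` IS FINITE LOCALLY FREE OF RANK `r` — from `H¹ = 0` and `h⁰ = r` on the fibres** (Mumford §5 Cor. 2–3 / Hartshorne
III 12.11 (b), Cor. 12.9; MFK Prop. 6.13 «`π_* L` is locally free of rank `r`»): `S` locally noetherian, `p : X → S` proper flat,
`G` finite locally free with `p_* G` affine-localizing, and on EVERY fibre square `X₀ = X ×_S Spec K` over a field point,
`Ext¹(𝒪_{X₀}, G|_{X₀}) = 0` (`hvan`, the G10 binder) and `dim_{Γ(Spec K, 𝒪)} Γ(X₀, G|_{X₀}) = r` (`hrank`).  Then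
`HasRank (p_* G) r`.  Proof: the frame-system road of ★ `hasRank_pushforward_unit_of_finrank_eq` — over an affine `V ∋ y`,
`Γ(p_* G, V)` is finite projective of stalk rank `r` (§2), so a basis of a localisation `Γ(p_* G, V)_g`, `g ∉ 𝔭_y` (★
`exists_basis_localizedModule_away`), frames `p_* G` on `D(g)` (★ `nonempty_basis_sections_basicOpen`, ★
`nonempty_free_iso_over_of_basis`) with `r` elements (★ `natCard_eq_rankAtStalk_of_basis_localizedModule_away`).
[cite: MumfordAV1970, §5 Cor. 2 (p. 50)] [cite: Hartshorne1977, III Thm. 12.11 (p. 290), Cor. 12.9]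
[cite: MumfordFogartyKirwan1994, Ch. 6 §2 Proposition 6.13 (p. 123)] -/
theorem hasRank_pushforward_of_forall_fieldPoint {S X : Scheme.{0}} [IsLocallyNoetherian S] {p : X ⟶ S} [IsProper p]
    [Flat p] (G : X.Modules) (hL : IsFiniteLocallyFree G)
    (hN : IsAffineLocalizing ((Scheme.Modules.pushforward p).obj G)) (r : ℕ)
    (hvan : ∀ ⦃K : Type⦄ [Field K] ⦃X₀ : Scheme.{0}⦄ (i : X₀ ⟶ X) (f₀ : X₀ ⟶ Spec (CommRingCat.of K))
      (x : Spec (CommRingCat.of K) ⟶ S), IsPullback i f₀ p x →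
        Subsingleton (Ext.{1} (unitModule X₀) ((Scheme.Modules.pullback i).obj G) 1))
    (hrank : ∀ ⦃K : Type⦄ [Field K] ⦃X₀ : Scheme.{0}⦄ (i : X₀ ⟶ X) (f₀ : X₀ ⟶ Spec (CommRingCat.of K))
      (x : Spec (CommRingCat.of K) ⟶ S), IsPullback i f₀ p x →
        Module.finrank Γ(Spec (CommRingCat.of K), ⊤) (SecMod ((Scheme.Modules.pullback i).obj G) f₀.appTop.hom ⊤) = r) :
    HasRank ((Scheme.Modules.pushforward p).obj G) r := by
  classical
  let E : S.Modules := (Scheme.Modules.pushforward p).obj G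
  have key : ∀ y : S, ∃ (U : S.Opens) (_ : y ∈ U) (ι : Type) (_ : Finite ι) (_ : Nat.card ι = r),
      Nonempty (SheafOfModules.free ι ≅ E.over U) := by
    intro y
    obtain ⟨_, ⟨V, hV, rfl⟩, hyV, -⟩ :=
      S.isBasis_affineOpens.exists_subset_of_mem_open (Set.mem_univ y) isOpen_univ
    obtain ⟨hfin, hproj, hrk⟩ := finite_projective_rankAtStalk_app_pushforward G hL r hvan hrank hV
    haveI : Module.Finite Γ(S, V) Γ(E, V) := hfin
    haveI : Module.Projective Γ(S, V) Γ(E, V) := hproj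
    haveI : Module.Flat Γ(S, V) Γ(E, V) := inferInstance
    obtain ⟨g, hg, ι, hι, ⟨b⟩⟩ := exists_basis_localizedModule_away Γ(E, V) (hV.primeIdealOf ⟨y, hyV⟩).asIdeal
    obtain ⟨bD⟩ := nonempty_basis_sections_basicOpen hN hV g b
    obtain ⟨e⟩ := nonempty_free_iso_over_of_basis E hN (hV.basicOpen g) bD
    refine ⟨S.basicOpen g, (mem_basicOpen_iff_not_mem_primeIdealOf hV g hyV).mpr hg, ι, hι, ?_, ⟨e⟩⟩
    rw [natCard_eq_rankAtStalk_of_basis_localizedModule_away (hV.primeIdealOf ⟨y, hyV⟩) hg b]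
    exact hrk _
  choose U hU ι hι hcard e using key
  exact FrameSystem.hasRank
    { U := U
      mem := hU
      I := ι
      rank := fun _ => r
      enum := fun y => haveI := hι y; (Finite.equivFin (ι y)).trans (finCongr (hcard y))
      frame := fun y => (e y).some } r fun _ => rfl

/-- **`p_* G` is finite locally free** under the same hypotheses (★ `HasRank.isFiniteLocallyFree'`).
[cite: MumfordAV1970, §5 Cor. 2 (p. 50)] [cite: Hartshorne1977, III Thm. 12.11 (p. 290)] -/
theorem isFiniteLocallyFree_pushforward_of_forall_fieldPoint {S X : Scheme.{0}} [IsLocallyNoetherian S] {p : X ⟶ S}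
    [IsProper p] [Flat p] (G : X.Modules) (hL : IsFiniteLocallyFree G)
    (hN : IsAffineLocalizing ((Scheme.Modules.pushforward p).obj G)) (r : ℕ)
    (hvan : ∀ ⦃K : Type⦄ [Field K] ⦃X₀ : Scheme.{0}⦄ (i : X₀ ⟶ X) (f₀ : X₀ ⟶ Spec (CommRingCat.of K))
      (x : Spec (CommRingCat.of K) ⟶ S), IsPullback i f₀ p x →
        Subsingleton (Ext.{1} (unitModule X₀) ((Scheme.Modules.pullback i).obj G) 1))
    (hrank : ∀ ⦃K : Type⦄ [Field K] ⦃X₀ : Scheme.{0}⦄ (i : X₀ ⟶ X) (f₀ : X₀ ⟶ Spec (CommRingCat.of K))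
      (x : Spec (CommRingCat.of K) ⟶ S), IsPullback i f₀ p x →
        Module.finrank Γ(Spec (CommRingCat.of K), ⊤) (SecMod ((Scheme.Modules.pullback i).obj G) f₀.appTop.hom ⊤) = r) :
    IsFiniteLocallyFree ((Scheme.Modules.pushforward p).obj G) :=
  HasRank.isFiniteLocallyFree' (hasRank_pushforward_of_forall_fieldPoint G hL hN r hvan hrank)

/-- **The same over a (quasi-compact) noetherian base, with no affine-localizing hypothesis**: `X` is then a noetherian scheme
and `p_* G` is affine-localizing by ★ `isAffineLocalizing_pushforward`.
[cite: MumfordAV1970, §5 Cor. 2 (p. 50)] [cite: Hartshorne1977, III Thm. 12.11 (p. 290), Cor. 12.9] [cite: Hartshorne1977, II Prop. 5.8 (c) (p. 115)] -/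
theorem hasRank_pushforward_of_forall_fieldPoint_of_compactSpace {S X : Scheme.{0}} [IsLocallyNoetherian S]
    [CompactSpace S] {p : X ⟶ S} [IsProper p] [Flat p] (G : X.Modules) (hL : IsFiniteLocallyFree G) (r : ℕ)
    (hvan : ∀ ⦃K : Type⦄ [Field K] ⦃X₀ : Scheme.{0}⦄ (i : X₀ ⟶ X) (f₀ : X₀ ⟶ Spec (CommRingCat.of K))
      (x : Spec (CommRingCat.of K) ⟶ S), IsPullback i f₀ p x →
        Subsingleton (Ext.{1} (unitModule X₀) ((Scheme.Modules.pullback i).obj G) 1))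
    (hrank : ∀ ⦃K : Type⦄ [Field K] ⦃X₀ : Scheme.{0}⦄ (i : X₀ ⟶ X) (f₀ : X₀ ⟶ Spec (CommRingCat.of K))
      (x : Spec (CommRingCat.of K) ⟶ S), IsPullback i f₀ p x →
        Module.finrank Γ(Spec (CommRingCat.of K), ⊤) (SecMod ((Scheme.Modules.pullback i).obj G) f₀.appTop.hom ⊤) = r) :
    HasRank ((Scheme.Modules.pushforward p).obj G) r := by
  haveI := hL.isVectorBundle.1
  haveI : IsLocallyNoetherian X := LocallyOfFiniteType.isLocallyNoetherian p
  haveI : CompactSpace X := QuasiCompact.compactSpace_of_compactSpace p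
  haveI : IsNoetherian X := { }
  exact hasRank_pushforward_of_forall_fieldPoint G hL
    (isAffineLocalizing_pushforward p (IsAffineLocalizing.of_isQuasicoherent G)) r hvan hrank

end HasRank


end Literature.AlgebraicGeometry.Modules

end
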